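import Literature.Computability.AlgebraicComplexity.RectangularExponentBounds
import Literature.Barriers.MatrixMultiplication.UniversalMethodBarrierProducts
import Literature.Barriers.MatrixMultiplication.UniversalMethodBarrierAsymptoticRank
import Literature.Barriers.MatrixMultiplication.UniversalMethodBarrierCor28
import HarnessLib

/-!
# Schönhage's asymptotic sum inequality for `ω(1, k, 1)`, asymptotic-rank form — proved

Topic `Literature/Computability/AlgebraicComplexity`.  The rectangular asymptotic sum inequality in
the form used by the recent laser-method papers (Alman–Duan–Vassilevska Williams–Xu–Xu–Zhou 2025,
Thm. 3.2, citing Schönhage 1981 and Bläser 2013; Vassilevska Williams–Xu–Xu–Zhou 2024, §2):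

  `t · q^{ω(a,b,c)} ≤ R̃(⊕_{i=1}^t ⟨q^a, q^b, q^c⟩)`   (`t, q` positive integers),

here for the formats `(1, 1, k)` / `(1, k, 1)` and with the real dimension `q^k` replaced by any
integer `B ≥ a^k` (padding is monotone), in the tree's coordinates: `⊕^t ⟨a, a, B⟩` is the multiple
`⟨t⟩ ⊗ ⟨a, a, B⟩ = kroneckerTensor (unitTensor K t) (matMulTensor K a a B)` (`TensorMultiples.lean`),
`R̃ = asymptoticRank` (`AsymptoticSpectrum.lean`, the infimum `inf_n R(T^{⊗n})^{1/n}`), and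
`ω(1,1,k) = omegaRect K 1 1 k` (`RectangularExponent.lean`, rank form).

* `mul_rpow_omegaRect_le_asymptoticRank` — `t · a^{ω(1,1,k)} ≤ R̃(⟨t⟩ ⊗ ⟨a, a, B⟩)` for `t ≥ 1`,
  `a ≥ 2`, `B ≥ a^k`, `k ≥ 0`, over any field;
* `mul_rpow_omegaRect_mid_le_asymptoticRank` — the middle-slot form
  `t · a^{ω(1,k,1)} ≤ R̃(⟨t⟩ ⊗ ⟨a, B, a⟩)` (`ω(1,k,1) = ω(1,1,k)`, `omegaRect_one_mid_one`, and
  `R̃` is invariant under rotating the three factors, `asymptoticRank_rotate`).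

## Proof

For every `n ≥ 1` and `M ≥ 1`, with `L = M n` and `R_n = R(T^{⊗n})`, `T = ⟨t⟩ ⊗ ⟨a,a,B⟩`:
`T^{⊗L} ≥ ⟨t^L⟩ ⊗ ⟨a^L, a^L, B^L⟩` (`tensorRestrictsTo_kroneckerPow_multiple_matMulTensor`, a
relabelling) and `R(T^{⊗L}) ≤ R_n^M`, so the rank form of the rectangular asymptotic sum inequality
(`rpow_omegaRect_le_of_tensorRank_multiple_le`, Bläser 2013 Lemma 7.7 / Thm. 7.5 for equal summands)
with `Q = ⌊R_n^M / t^L⌋ + 1` gives `(t a^{ω})^{nM} ≤ 2 R_n^M`; letting `M → ∞` (Bernoulli's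
inequality) `(t a^ω)^n ≤ R_n`, and the infimum over `n` is `R̃(T)`.  No Fekete lemma is needed.

## References

* J. Alman, R. Duan, V. Vassilevska Williams, Y. Xu, Z. Xu, R. Zhou, *More asymmetry yields faster
  matrix multiplication*, SODA 2025, arXiv:2404.16349, §3.4 Thm. 3.2 ("Asymptotic Sum Inequality for
  `ω(a,b,c)` [Schönhage81, Bläser]"). [AlmanDuanVassilevskaWilliamsXuXuZhou2025]
* M. Bläser, *Fast Matrix Multiplication*, ToC Graduate Surveys 5 (2013), Thm. 7.5, Lemma 7.7. [Blaser2013]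
* A. Schönhage, *Partial and total matrix multiplication*, SIAM J. Comput. 10 (1981) 434–455.
-/

noncomputable section

open scoped BigOperators

namespace Literature.Computability.AlgebraicComplexity

open Literature.Barriers.MatrixMultiplication

universe u

/-! ## Relabelling restrictions -/

section Restrictions

variable {K : Type u} [CommSemiring K]
variable {ι κ μ : Type*} [Fintype ι] [Fintype κ] [Fintype μ] [DecidableEq ι] [DecidableEq κ]
  [DecidableEq μ]

/-- `t^{⊗1} ≥ t` (relabelling along `Fin 1 → ι ≅ ι`). [folklore] -/
theorem tensorRestrictsTo_kroneckerPow_one (t : ι → κ → μ → K) :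
    TensorRestrictsTo (kroneckerPow t 1) t := by
  have h := tensorRestrictsTo_precomp (kroneckerPow t 1) (fun (a : ι) (_ : Fin 1) => a)
    (fun (b : κ) (_ : Fin 1) => b) (fun (c : μ) (_ : Fin 1) => c)
  simpa [kroneckerPow_apply] using h

variable (K) in
/-- **Powers of a multiple of a matrix multiplication tensor**:
`(⟨F⟩ ⊗ ⟨A,B,C⟩)^{⊗L} ≥ ⟨F^L⟩ ⊗ ⟨A^L, B^L, C^L⟩` (iterate `⟨k,m,n⟩ ⊗ ⟨k',m',n'⟩ ≅ ⟨kk',mm',nn'⟩`,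
Bläser 2013, p. 24, and `⟨F⟩ ⊗ ⟨F'⟩ ≅ ⟨FF'⟩`). [cite: Blaser2013, §5.2 p. 24] -/
theorem tensorRestrictsTo_kroneckerPow_multiple_matMulTensor (F A B C L : ℕ) :
    TensorRestrictsTo (kroneckerPow (kroneckerTensor (unitTensor K F) (matMulTensor K A B C)) L)
      (kroneckerTensor (unitTensor K (F ^ L)) (matMulTensor K (A ^ L) (B ^ L) (C ^ L))) := by
  induction L with
  | zero =>
    refine ⟨fun _ _ => 1, fun _ _ => 1, fun _ _ => 1, fun a' b' c' => ?_⟩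
    obtain ⟨a₁, a₂, a₃⟩ := a'
    obtain ⟨b₁, b₂, b₃⟩ := b'
    obtain ⟨c₁, c₂, c₃⟩ := c'
    have ha₁ : a₁ = 0 := Fin.fin_one_eq_zero a₁
    have hb₁ : b₁ = 0 := Fin.fin_one_eq_zero b₁
    have hc₁ : c₁ = 0 := Fin.fin_one_eq_zero c₁
    have ha₂ : a₂ = 0 := Fin.fin_one_eq_zero a₂
    have hb₂ : b₂ = 0 := Fin.fin_one_eq_zero b₂
    have hc₂ : c₂ = 0 := Fin.fin_one_eq_zero c₂
    have ha₃ : a₃ = 0 := Fin.fin_one_eq_zero a₃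
    have hb₃ : b₃ = 0 := Fin.fin_one_eq_zero b₃
    have hc₃ : c₃ = 0 := Fin.fin_one_eq_zero c₃
    subst ha₁ hb₁ hc₁ ha₂ hb₂ hc₂ ha₃ hb₃ hc₃
    simp [matMulTensor]
  | succ L ih =>
    set T := kroneckerTensor (unitTensor K F) (matMulTensor K A B C) with hT
    have h1 : TensorRestrictsTo (kroneckerPow T (L + 1))
        (kroneckerTensor (kroneckerPow T L) (kroneckerPow T 1)) :=
      tensorRestrictsTo_kroneckerPow_add T L 1
    have h2 : TensorRestrictsTo (kroneckerTensor (kroneckerPow T L) (kroneckerPow T 1))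
        (kroneckerTensor
          (kroneckerTensor (unitTensor K (F ^ L)) (matMulTensor K (A ^ L) (B ^ L) (C ^ L))) T) :=
      ih.kronecker (tensorRestrictsTo_kroneckerPow_one T)
    have h3 := tensorRestrictsTo_kronecker_multiple_matMulTensor K (F ^ L) (A ^ L) (B ^ L) (C ^ L)
      F A B C
    have h4 := tensorRestrictsTo_multiple_matMulTensor_of_eq K (pow_succ F L).symm
      (pow_succ A L).symm (pow_succ B L).symm (pow_succ C L).symm
    exact h1.trans (h2.trans (h3.trans h4))

end Restrictions

/-! ## The asymptotic-rank form of the rectangular asymptotic sum inequality -/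

section ASI

/-- **Schönhage's asymptotic sum inequality for `ω(1,1,k)`, asymptotic-rank form** (ADVXXZ 2025,
Thm. 3.2, after Schönhage 1981 / Bläser 2013: `t · q^{ω(a,b,c)} ≤ R̃(⊕_{i=1}^t ⟨q^a,q^b,q^c⟩)`), for
the format `(1, 1, k)` with the third dimension padded to any integer `B ≥ a^k`: for `t ≥ 1`,
`a ≥ 2`, `k ≥ 0`, `a^k ≤ B`, over any field, `t · a^{ω(1,1,k)} ≤ R̃(⟨t⟩ ⊗ ⟨a, a, B⟩)`.
[cite: AlmanDuanVassilevskaWilliamsXuXuZhou2025, Thm. 3.2] -/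
theorem mul_rpow_omegaRect_le_asymptoticRank (K : Type) [Field K] {k : ℝ} (hk : 0 ≤ k)
    {t a B : ℕ} (ht : 1 ≤ t) (ha : 2 ≤ a) (haB : (a : ℝ) ^ k ≤ B) :
    (t : ℝ) * (a : ℝ) ^ omegaRect K 1 1 k ≤
      asymptoticRank (kroneckerTensor (unitTensor K t) (matMulTensor K a a B)) := by
  set T := kroneckerTensor (unitTensor K t) (matMulTensor K a a B) with hT
  set ω₀ : ℝ := omegaRect K 1 1 k with hω
  have ha0 : (0 : ℝ) < a := by exact_mod_cast (by omega : 0 < a)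
  have ht0 : (0 : ℝ) < t := by exact_mod_cast (by omega : 0 < t)
  have hB1 : 1 ≤ B := by
    have h1 : (1 : ℝ) ≤ (a : ℝ) ^ k := Real.one_le_rpow (by exact_mod_cast (by omega : 1 ≤ a)) hk
    exact_mod_cast h1.trans haB
  set x : ℝ := (t : ℝ) * (a : ℝ) ^ ω₀ with hx
  have hx0 : 0 < x := by positivity
  -- Step 1: `x^{Mn} ≤ 2 R(T^{⊗n})^M`
  have step : ∀ n M : ℕ, 1 ≤ n → 1 ≤ M →
      x ^ (M * n) ≤ 2 * ((tensorRank (kroneckerPow T n) : ℝ)) ^ M := by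
    intro n M hn hM
    set L := M * n with hL
    have hL0 : L ≠ 0 := Nat.mul_ne_zero (by omega) (by omega)
    set Rn := tensorRank (kroneckerPow T n) with hRn
    -- `R(⟨t^L⟩ ⊗ ⟨a^L,a^L,B^L⟩) ≤ R(T^{⊗L}) ≤ R_n^M`
    have hchain : tensorRank (kroneckerTensor (unitTensor K (t ^ L))
        (matMulTensor K (a ^ L) (a ^ L) (B ^ L))) ≤ Rn ^ M :=
      calc tensorRank (kroneckerTensor (unitTensor K (t ^ L)) (matMulTensor K (a ^ L) (a ^ L) (B ^ L)))
          ≤ tensorRank (kroneckerPow T L) :=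
            (tensorRestrictsTo_kroneckerPow_multiple_matMulTensor K t a a B L).tensorRank_le
        _ = tensorRank (kroneckerPow (kroneckerPow T n) M) := by
            rw [hL, tensorRank_kroneckerPow_mul]
        _ ≤ Rn ^ M := tensorRank_kroneckerPow_le _ M
    -- `t^L ≤ R_n^M`
    have htL : t ^ L ≤ Rn ^ M := by
      refine le_trans ?_ hchain
      haveI : NeZero (a ^ L) := ⟨pow_ne_zero _ (by omega)⟩
      haveI : NeZero (B ^ L) := ⟨pow_ne_zero _ (by omega)⟩
      exact le_tensorRank_multiple (t ^ L) (matMulTensor K (a ^ L) (a ^ L) (B ^ L))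
        (a₀ := ((0 : Fin (a ^ L)), (0 : Fin (B ^ L)))) (b₀ := ((0 : Fin (a ^ L)), (0 : Fin (a ^ L))))
        (c₀ := ((0 : Fin (a ^ L)), (0 : Fin (B ^ L)))) (by simp [matMulTensor])
    -- the rank form of the rectangular asymptotic sum inequality with `Q = R_n^M / t^L + 1`
    set Q := Rn ^ M / t ^ L + 1 with hQ
    have htL0 : 0 < t ^ L := pow_pos (by omega) L
    have hmul : tensorRank (kroneckerTensor (unitTensor K (t ^ L))
        (matMulTensor K (a ^ L) (a ^ L) (B ^ L))) ≤ Q * t ^ L := by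
      refine hchain.trans ?_
      rw [hQ, add_mul, one_mul]
      exact (Nat.lt_div_mul_add htL0).le
    have haL : 2 ≤ a ^ L := le_trans ha (Nat.le_self_pow hL0 a)
    have habL : ((a ^ L : ℕ) : ℝ) ^ k ≤ ((B ^ L : ℕ) : ℝ) := by
      rw [Nat.cast_pow, Nat.cast_pow, ← Real.rpow_natCast_mul ha0.le, mul_comm,
        Real.rpow_mul_natCast ha0.le]
      exact pow_le_pow_left₀ (Real.rpow_nonneg ha0.le k) haB L
    have key := rpow_omegaRect_le_of_tensorRank_multiple_le K hk (Nat.one_le_pow L t (by omega))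
      haL habL hmul
    -- `Q ≤ 2 R_n^M / t^L`
    have hQle : (Q : ℝ) ≤ 2 * ((Rn : ℝ) ^ M / (t : ℝ) ^ L) := by
      rw [hQ]
      push_cast
      have h1 : ((Rn ^ M / t ^ L : ℕ) : ℝ) ≤ (Rn : ℝ) ^ M / (t : ℝ) ^ L := by
        rw [le_div_iff₀ (by positivity)]
        exact_mod_cast Nat.div_mul_le_self _ _
      have h2 : (1 : ℝ) ≤ (Rn : ℝ) ^ M / (t : ℝ) ^ L := by
        rw [one_le_div (by positivity)]
        exact_mod_cast htL
      linarith
    have e1 : ((a : ℝ) ^ ω₀) ^ L = (((a ^ L : ℕ) : ℝ)) ^ ω₀ := by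
      rw [Nat.cast_pow, ← Real.rpow_mul_natCast ha0.le, mul_comm, Real.rpow_natCast_mul ha0.le]
    calc x ^ (M * n) = (t : ℝ) ^ L * (((a ^ L : ℕ) : ℝ)) ^ ω₀ := by
          rw [hx, mul_pow, e1]
      _ ≤ (t : ℝ) ^ L * Q := by gcongr
      _ ≤ (t : ℝ) ^ L * (2 * ((Rn : ℝ) ^ M / (t : ℝ) ^ L)) := by gcongr
      _ = 2 * (Rn : ℝ) ^ M := by field_simp
  -- Step 2: `x^n ≤ R(T^{⊗n})` (let `M → ∞`, Bernoulli)
  have step2 : ∀ n : ℕ, 1 ≤ n → x ^ n ≤ (tensorRank (kroneckerPow T n) : ℝ) := by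
    intro n hn
    set y : ℝ := (tensorRank (kroneckerPow T n) : ℝ) with hy
    by_contra hlt
    rw [not_le] at hlt
    have hy0 : 0 < y := by
      have h := step n 1 hn le_rfl
      rw [one_mul, pow_one] at h
      have hxn : 0 < x ^ n := pow_pos hx0 n
      linarith
    set r : ℝ := x ^ n / y with hr
    have hr1 : 1 < r := (one_lt_div hy0).2 hlt
    have hbound : ∀ M : ℕ, 1 ≤ M → r ^ M ≤ 2 := by
      intro M hM
      have h := step n M hn hM
      rw [hr, div_pow, div_le_iff₀ (pow_pos hy0 M), ← pow_mul, mul_comm n M]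
      exact h
    have hd : 0 < r - 1 := by linarith
    obtain ⟨M, hM⟩ := exists_nat_gt (1 / (r - 1))
    have hMpos : (0 : ℝ) < M := lt_trans (by positivity) hM
    have hM1 : 1 ≤ M := Nat.one_le_iff_ne_zero.2 (by rintro rfl; simp at hMpos)
    have hB := one_add_mul_le_pow (show (-2 : ℝ) ≤ r - 1 by linarith) M
    rw [add_sub_cancel] at hB
    have h1 : 1 < (M : ℝ) * (r - 1) := by rwa [div_lt_iff₀ hd] at hM
    linarith [hbound M hM1]
  -- Step 3: the infimum defining `R̃`
  refine le_ciInf fun N => ?_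
  have h := step2 (N + 1) (Nat.succ_pos N)
  have hexp : (0 : ℝ) < (N : ℝ) + 1 := by positivity
  calc x = (x ^ (N + 1)) ^ ((N : ℝ) + 1)⁻¹ := by
        rw [← Real.rpow_natCast, ← Real.rpow_mul hx0.le]
        push_cast
        rw [mul_inv_cancel₀ hexp.ne', Real.rpow_one]
    _ ≤ ((tensorRank (kroneckerPow T (N + 1)) : ℝ)) ^ ((N : ℝ) + 1)⁻¹ :=
        Real.rpow_le_rpow (by positivity) h (by positivity)

/-- `R̃(⟨F⟩ ⊗ ⟨Q,R,P⟩) ≤ R̃(⟨F⟩ ⊗ ⟨P,Q,R⟩)`: rotating the three factors of a multiple of a matrix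
multiplication tensor does not change its asymptotic rank (Bläser 2013, Lemma 5.5 for `R̃`; as in
the proof of `flattenings_le_asymptoticRank_multiple`). [cite: Blaser2013, Lemma 5.5] -/
theorem asymptoticRank_multiple_matMulTensor_rotate_le (K : Type) [Field K] (F P Q R : ℕ) :
    asymptoticRank (kroneckerTensor (unitTensor K F) (matMulTensor K Q R P)) ≤
      asymptoticRank (kroneckerTensor (unitTensor K F) (matMulTensor K P Q R)) := by
  rw [← asymptoticRank_rotate (kroneckerTensor (unitTensor K F) (matMulTensor K P Q R))]
  exact asymptoticRank_le_of_polyDegeneratesTo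
    (tensorRestrictsTo_rotate_multiple_matMulTensor K F P Q R).polyDegeneratesTo

/-- **Schönhage's asymptotic sum inequality for `ω(1,k,1)`** (the middle-slot form used by
ADVXXZ 2025, Thm. 3.2 and §7: `V · q^{ω(1,κ,1)} ≤ R̃(⊕^V ⟨q, q^κ, q⟩)`): for `t ≥ 1`, `a ≥ 2`,
`k ≥ 0` and any integer `B ≥ a^k`, over any field, `t · a^{ω(1,k,1)} ≤ R̃(⟨t⟩ ⊗ ⟨a, B, a⟩)`
(`ω(1,k,1) = ω(1,1,k)` and `R̃(⟨t⟩ ⊗ ⟨a,a,B⟩) ≤ R̃(⟨t⟩ ⊗ ⟨B,a,a⟩) ≤ R̃(⟨t⟩ ⊗ ⟨a,B,a⟩)` by rotation).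
[cite: AlmanDuanVassilevskaWilliamsXuXuZhou2025, Thm. 3.2] -/
theorem mul_rpow_omegaRect_mid_le_asymptoticRank (K : Type) [Field K] {k : ℝ} (hk : 0 ≤ k)
    {t a B : ℕ} (ht : 1 ≤ t) (ha : 2 ≤ a) (haB : (a : ℝ) ^ k ≤ B) :
    (t : ℝ) * (a : ℝ) ^ omegaRect K 1 k 1 ≤
      asymptoticRank (kroneckerTensor (unitTensor K t) (matMulTensor K a B a)) := by
  rw [omegaRect_one_mid_one]
  exact (mul_rpow_omegaRect_le_asymptoticRank K hk ht ha haB).trans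
    ((asymptoticRank_multiple_matMulTensor_rotate_le K t B a a).trans
      (asymptoticRank_multiple_matMulTensor_rotate_le K t a B a))

end ASI

end Literature.Computability.AlgebraicComplexity

end
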